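import Mathlib
import HarnessLib
import Summits.QuantumFields.YangMills.Theses.ScalingWindowSplit
import Summits.QuantumFields.YangMills.Theorems.MirrorModularBoostsHypercubicLimitCouplingResponseDefsC
import Summits.QuantumFields.YangMills.Theorems.ScalingWindowSplitSelfNormalisedMomentBoundsRStubPlaneMean
import Summits.QuantumFields.YangMills.Theorems.ScalingWindowSplitSelfNormalisedMomentBoundsRStubEventually
import Summits.QuantumFields.YangMills.Theorems.ScalingWindowSplitSelfNormalisedMomentBoundsRStubFlatPoint
import Summits.QuantumFields.YangMills.Theorems.ScalingWindowSplitSelfNormalisedMomentBoundsRStubRiemannBound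
import Summits.QuantumFields.YangMills.Theorems.ScalingWindowSplitSelfNormalisedMomentBoundsRStubAssembly
import Summits.QuantumFields.YangMills.Cruxes.SelfNormalisedMomentBoundsR.MaskedSectorObstruction
import Summits.QuantumFields.YangMills.Theorems.ScalingWindowSplitSelfNormalisedMomentBoundsROfClusterBound

/-!
# Crux `SelfNormalisedMomentBoundsR` — line `Sketch` TRANSFERRED to the repaired crux U_RS (courtesy file)

The census (§1, `MaskedSectorObstruction.lean`) refutes U_R as typed (ALL compact `G`) modulo (P1)+(P2) by the masked
product group `U(1) × SU(2)` and certifies the one-token repair U_RS = `Strategist.SelfNormalisedMomentBoundsRS`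
(`IsCompactSimpleLieGroup G →` inserted; glue `closesRS` / `existenceLegFromLatticeRS`).  This file shows that line
`Sketch` transfers to U_RS VERBATIM: the eight landed stubs (`stub_planeMean` p159510, `stub_eventually` p159318,
`stub_flatPoint` p159056, `stub_riemannBound` p159357, `stub_expansion` p160824, `stub_vertexBound` p160942,
`stub_riemannSqrt` p160617, `stub_assembly` p161368) are statements about ONE scheme at ONE step and never read the
group; only the physics stub changes, to `stub_clusterBoundS` = `stub_clusterBound` with the simplicity hypothesis —
the honest ultraviolet kernel K_UV for compact SIMPLE `G` in cluster-expansion output format (functional-graph bound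
with the dimension-4 kernel `(a_k d_torus)⁻⁴` on canon-normalised centred plaquette correlations at distinct sites).
`selfNormalisedMomentBoundsRS_of` concludes U_RS; with `closesRS` the route closes from W₁, U_RS, CurvatureAmnesia, W₂.
Not registrable (U_RS is not an item); published so that the restate R1 costs the planners nothing on this line.
-/

noncomputable section

open scoped SchwartzMap BigOperators Topology
open MeasureTheory Filter Topology
open Literature.MathematicalPhysics.AQFT Literature.MathematicalPhysics.QuantumLattice
open Literature.MathematicalPhysics.QuantumFieldTheory Literature.Probability.LatticeModels
open Summit.QuantumFields.YangMills.Cruxes.HypercubicLimit.CouplingResponse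

namespace Summit.QuantumFields.YangMills.Theorems.ScalingWindowSplit.SelfNormalisedMomentBoundsR.RS

/-! ## Stub 2 — the physics stub: functional-graph cluster bound for the self-normalised scheme -/

/-- **`stub_clusterBoundS` — the physics stub of line `Sketch` for compact SIMPLE `G` (the honest kernel K_UV).**  At every admissible datum
`(G, r, sch, u, p, M)` of the crux (weak coupling, polynomial volumes, past-supported `u`, floor and window) there are
`C ≥ 1` and `k₀` such that for all `k ≥ k₀`, all `n ≥ 2` and all injective families of sites `x₁ … xₙ` of the box
with plane labels `q₁ … qₙ`, the centred plaquette correlation normalised by `c'_k = 1/√T⁰_k(u,θu)` per insertion obeys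
`|c'_kⁿ ∫ ∏ᵢ (O_{qᵢ}(τ_{xᵢ}Ũ) − m'_k/6) dμ_k| ≤ Cⁿ Σ_{f fixed-point-free} ∏ᵢ (a_k d_k(xᵢ, x_{f i}))⁻⁴`, `d_k` the torus
distance in lattice units.  For the free Wick square the left side is a sum over CYCLES of `∏ d⁻⁴` (a sub-sum of the
right side); nearest-neighbour products dominate every hierarchical configuration (`δδ′ ≤ D²`).  This is the
crux-by-name residue: expected for compact SIMPLE `G` (asymptotic freedom read on `tr F²`), refuted modulo (P1)+(P2)
for `U(1) × SU(2)` exactly as the crux itself (census §1). [folklore] -/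
theorem stub_clusterBoundS :
    ∀ (G : Type) [Group G] [TopologicalSpace G] [IsTopologicalGroup G] [CompactSpace G] [MeasurableSpace G]
      [BorelSpace G], IsCompactSimpleLieGroup G → ∀ (r : LatticeRep G) (sch : SpeciesScheme (YMSpecies G)) (u : 𝓢(EuclideanSpace ℝ (Fin 4), ℝ))
      (p : ℕ) (M : ℝ),
      let bare : SpeciesScheme (YMSpecies G) := { sch with c := fun _ _ => 1, m := fun _ _ => 0 }
      let T : 𝓢(EuclideanSpace ℝ (Fin 4), ℝ) → ℕ → ℝ := fun w k =>
        latticeSchwinger r.ρ bare (fun s => s.F) k (1 + 1) (fun _ => r.curvature) ![w, thetaTest 4 w] -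
          latticeSchwinger r.ρ bare (fun s => s.F) k 1 (fun _ => r.curvature) ![w] *
            latticeSchwinger r.ρ bare (fun s => s.F) k 1 (fun _ => r.curvature) ![thetaTest 4 w]
      let canon : SpeciesScheme (YMSpecies G) :=
        { sch with
          c := fun _ k => (Real.sqrt (T u k))⁻¹
          m := fun _ k => ∫ U, r.curvature.F (torusLift (sch.side k) U) ∂(wilsonMeasure r.ρ (sch.β k)) }
      sch.HasWeakCouplingLimit →
      (∃ N : ℕ, 1 ≤ N ∧ ∀ᶠ k in atTop, (sch.a k)⁻¹ ≤ (sch.a k * (sch.L k : ℝ)) ^ N) →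
      tsupport u ⊆ {y : EuclideanSpace ℝ (Fin 4) | y 0 < 0} →
      (∀ᶠ k in atTop, (sch.a k) ^ p ≤ T u k ∧ T u k ≤ M * T (timeShiftTest 4 (-1) u) k) →
      ∃ (C : ℝ) (k₀ : ℕ), 1 ≤ C ∧ ∀ k : ℕ, k₀ ≤ k →
        ∀ (n : ℕ) (x : Fin n → Site 4) (q : Fin n → Plane), 2 ≤ n → Function.Injective x →
          (∀ i, x i ∈ box 4 (canon.L k)) →
          |canon.c r.curvature k ^ n *
              ∫ U, ∏ i, ((planeSpecies r (q i)).F (configShift (-(x i)) (torusLift (canon.side k) U)) -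
                canon.m r.curvature k / 6) ∂(wilsonAt r canon k)| ≤
            C ^ n * ∑ f : Fin n → Fin n, (if ∀ i, f i ≠ i then
              ∏ i, ((canon.a k * ‖siteToE (fun μ : Fin 4 =>
                ((((x i μ - x (f i) μ : ℤ) : ZMod (canon.side k)).valMinAbs : ℤ)))‖)⁻¹) ^ 4 else 0) := by
  sorry

/-! ## The composition: the stubs conclude the crux BY NAME -/

/-- **`selfNormalisedMomentBoundsRS_of` — the line's composition, re-pointed at U_RS.**  Fix a datum; the crux's conclusion is
`UniformMomentBoundsPlanes r canon` by `Iff.rfl`.  `stub_clusterBound` gives `(C, k₀)`; polynomial volumes give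
`N`, and `stub_assembly N` (fed `stub_flatPoint`, `stub_riemannBound`) gives `(s, K)`; for `k` beyond `k₀` and
beyond the eventualities `a_k ≤ 1`, `a_k L_k ≥ 1`, `a_k⁻¹ ≤ (a_k L_k)^N` the assembly (with `stub_planeMean` for
the torus-mean-centred scheme `canon`) bounds the moments by `K (K C)ⁿ n!`; `stub_eventually` removes the threshold.
[folklore] -/
theorem selfNormalisedMomentBoundsRS_of :
    Summit.QuantumFields.YangMills.Cruxes.SelfNormalisedMomentBoundsR.Strategist.SelfNormalisedMomentBoundsRS := by
  intro G _ _ _ _ _ _ hG r sch u p M bare T canon hw hpv hu hfw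
  show UniformMomentBoundsPlanes r canon
  -- the physics stub at the datum
  obtain ⟨C, k₀, hC1, hcl⟩ := stub_clusterBoundS G hG r sch u p M hw hpv hu hfw
  -- the volume exponent and the assembly constants
  obtain ⟨N, -, hpvN⟩ := hpv
  obtain ⟨s, K, hK, hassem⟩ := stub_assembly stub_flatPoint stub_riemannBound N
  -- the eventualities of the scheme: `a_k ≤ 1`, `a_k L_k ≥ 1`, polynomial volumes
  have ha1 : ∀ᶠ k in atTop, sch.a k ≤ 1 :=
    (sch.tendsto_a.eventually (Iic_mem_nhds (zero_lt_one' ℝ))).mono fun k hk => hk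
  have haL : ∀ᶠ k in atTop, 1 ≤ sch.a k * (sch.L k : ℝ) := sch.tendsto_L.eventually_ge_atTop 1
  obtain ⟨k₁, hk₁⟩ := (ha1.and (haL.and hpvN)).exists_forall_of_atTop
  -- the one-point identity for `canon` (its counterterm IS the torus mean)
  have h1 : ∀ k (q : Plane) (f : 𝓢(EuclideanSpace ℝ (Fin 4), ℝ)),
      ∫ U, planeField r canon k q f U ∂(wilsonAt r canon k) = 0 :=
    fun k => stub_planeMean G r canon k rfl
  -- assemble on the tail `k ≥ max k₀ k₁`
  refine stub_eventually G r canon ⟨s, max k₀ k₁, K, K * C, fun n F hF hD k hk => ?_⟩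
  have hk0 : k₀ ≤ k := (le_max_left _ _).trans hk
  obtain ⟨hak, haLk, hpvk⟩ := hk₁ k ((le_max_right _ _).trans hk)
  exact hassem G r canon k C hC1 hak haLk hpvk (h1 k) (hcl k hk0) n F hF hD

end Summit.QuantumFields.YangMills.Theorems.ScalingWindowSplit.SelfNormalisedMomentBoundsR.RS

/-- With the census glue: W₁, U_RS (hence this line's physics stub for simple `G`), CurvatureAmnesia, W₂ and the
proved EuclideanUpgrade close the route (`closesRS`). [folklore] -/
theorem Summit.QuantumFields.YangMills.Theorems.ScalingWindowSplit.SelfNormalisedMomentBoundsR.RS.closes_of_clusterBoundS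
    (hW : Summit.QuantumFields.YangMills.Theses.ScalingWindowSplit.GapAtCorrelationLength)
    (hA : Summit.QuantumFields.YangMills.Theses.ScalingWindowSplit.CurvatureAmnesia)
    (hS : Summit.QuantumFields.YangMills.Theses.ScalingWindowSplit.SelfNormalisedSkewness)
    (hUpg : Summit.QuantumFields.YangMills.Theses.ScalingWindowSplit.EuclideanUpgrade) : YangMills :=
  Summit.QuantumFields.YangMills.Cruxes.SelfNormalisedMomentBoundsR.Strategist.closesRS hW
    Summit.QuantumFields.YangMills.Theorems.ScalingWindowSplit.SelfNormalisedMomentBoundsR.RS.selfNormalisedMomentBoundsRS_of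
    hA hS hUpg

/-- **The physics stub inherits the crux's conditional refutation.**  Since the cluster bound (all compact `G`)
implies U_R (`selfNormalisedMomentBoundsR_of_clusterBound`, landed sorry-free over the line's stubs) and the census's
`selfNormalisedMomentBoundsR_false_of_twoRateHonestWindowScheme : TwoRateHonestWindowScheme → ¬U_R`, a two-rate
honest-window scheme (the masked product group `U(1) × SU(2)`, modulo (P1)+(P2)) refutes the all-`G` cluster bound —
which is why the line's honest target is `stub_clusterBoundS` (simple `G`). [folklore] -/
theorem Summit.QuantumFields.YangMills.Theorems.ScalingWindowSplit.SelfNormalisedMomentBoundsR.RS.clusterBound_false_of_twoRateHonestWindowScheme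
    (h : Summit.QuantumFields.YangMills.Cruxes.SelfNormalisedMomentBoundsR.Strategist.TwoRateHonestWindowScheme) :
    ¬
    (
    ∀ (G : Type) [Group G] [TopologicalSpace G] [IsTopologicalGroup G] [CompactSpace G] [MeasurableSpace G]
      [BorelSpace G] (r : LatticeRep G) (sch : SpeciesScheme (YMSpecies G)) (u : 𝓢(EuclideanSpace ℝ (Fin 4), ℝ))
      (p : ℕ) (M : ℝ),
      let bare : SpeciesScheme (YMSpecies G) := { sch with c := fun _ _ => 1, m := fun _ _ => 0 }
      let T : 𝓢(EuclideanSpace ℝ (Fin 4), ℝ) → ℕ → ℝ := fun w k =>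
        latticeSchwinger r.ρ bare (fun s => s.F) k (1 + 1) (fun _ => r.curvature) ![w, thetaTest 4 w] -
          latticeSchwinger r.ρ bare (fun s => s.F) k 1 (fun _ => r.curvature) ![w] *
            latticeSchwinger r.ρ bare (fun s => s.F) k 1 (fun _ => r.curvature) ![thetaTest 4 w]
      let canon : SpeciesScheme (YMSpecies G) :=
        { sch with
          c := fun _ k => (Real.sqrt (T u k))⁻¹
          m := fun _ k => ∫ U, r.curvature.F (torusLift (sch.side k) U) ∂(wilsonMeasure r.ρ (sch.β k)) }
      sch.HasWeakCouplingLimit →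
      (∃ N : ℕ, 1 ≤ N ∧ ∀ᶠ k in atTop, (sch.a k)⁻¹ ≤ (sch.a k * (sch.L k : ℝ)) ^ N) →
      tsupport u ⊆ {y : EuclideanSpace ℝ (Fin 4) | y 0 < 0} →
      (∀ᶠ k in atTop, (sch.a k) ^ p ≤ T u k ∧ T u k ≤ M * T (timeShiftTest 4 (-1) u) k) →
      ∃ (C : ℝ) (k₀ : ℕ), 1 ≤ C ∧ ∀ k : ℕ, k₀ ≤ k →
        ∀ (n : ℕ) (x : Fin n → Site 4) (q : Fin n → Plane), 2 ≤ n → Function.Injective x →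
          (∀ i, x i ∈ box 4 (canon.L k)) →
          |canon.c r.curvature k ^ n *
              ∫ U, ∏ i, ((planeSpecies r (q i)).F (configShift (-(x i)) (torusLift (canon.side k) U)) -
                canon.m r.curvature k / 6) ∂(wilsonAt r canon k)| ≤
            C ^ n * ∑ f : Fin n → Fin n, (if ∀ i, f i ≠ i then
              ∏ i, ((canon.a k * ‖siteToE (fun μ : Fin 4 =>
                ((((x i μ - x (f i) μ : ℤ) : ZMod (canon.side k)).valMinAbs : ℤ)))‖)⁻¹) ^ 4 else 0)) :=
  fun hcb => Summit.QuantumFields.YangMills.Cruxes.SelfNormalisedMomentBoundsR.Strategist.selfNormalisedMomentBoundsR_false_of_twoRateHonestWindowScheme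
    h (Summit.QuantumFields.YangMills.Theorems.ScalingWindowSplit.SelfNormalisedMomentBoundsR.selfNormalisedMomentBoundsR_of_clusterBound hcb)

end
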